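import Summits.CriticalPhenomena.CardyFormulaZ2.Theorems.CardySelfRefinementCriticalPathRSWStubEnvelopePathCore

/-!
# Stub `envelopePath` of line `finite-size-envelope`, crux `CriticalPathRSW` (stmt-CriticalPhenomena-10267)

Pure real analysis / topology of the unit square, no percolation.  Let `U, V ⊆ ℝ²` be open,
disjoint on `[0,1]²`, `U` a down-set and `V` an up-set in the second coordinate `c`, the top edge
`[0,1] × {1} ⊆ V`, the bottom edge `[0,1] × {0}` disjoint from `V`, `(1,0) ∉ U`,
`(0,½) ∉ U ∪ V`, and let `U` be invariant under the flows `(ρ,c) ↦ (ρ-t, c-Ct)` for `c ≤ 1-δ`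
(`C = C(δ)`).  Then (`stub_envelopePath`) there is a continuous path `γ : [0,1] → [0,1]²` with
`γ 0 = (1,0)`, `γ 1 = (0,½)`, both coordinates of bounded variation on `univ`, avoiding `U ∪ V`.

Proof.  `K := [0,1]² ∖ (U ∪ V)` is closed (`env_isClosed_K`) with order-connected vertical
fibres (`env_ordConnected_fibre`: `U` down, `V` up).  Tube lemma (`env_tube`,
`IsCompact.exists_thickening_subset_open`): `[0,1] × [1-δ₀, 1] ⊆ V` for some `δ₀ ∈ (0,1)`, hence
by disjointness no point `(ρ, 1-δ₀)`, `ρ ∈ [0,1]`, is in `U`.  The lower envelope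
`cm ρ := sInf {c ≥ 0 | (ρ,c) ∉ U}` is attained (`env_cminus_spec`, `U` open), everything strictly
below it is in `U` (`env_mem_U_of_lt_cminus`), its graph over `[0,1]` lies in `K`
(`env_graph_mem`: a `V`-ball around a graph point would meet `U` just below the envelope), and
the flow at `δ = δ₀` with `t = ρ' - ρ` gives `cm ρ' ≤ cm ρ + C (ρ' - ρ)`, i.e. `cm - C·id` is
antitone on `[0,1]` (`env_antitone_cminus`).  With `cm 0 ≤ ½`, `(0,½), (1,0) ∈ K` the envelope
path `env_exists_path` of the core file
(`…Theorems/CardySelfRefinementCriticalPathRSWStubEnvelopePathCore.lean`) is the wanted `γ`.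

Design: no definitions — the envelope enters the lemmas as an arbitrary `cm : ℝ → ℝ` with its
defining equation `hcm`.  Adapted from the crux disprover's `Disproof.lean`
(refuter-cdisprove-stmt-CriticalPhenomena-10267-0, §10 `PhaseSets`), item evidence 2026-08-16;
the global cone there is replaced by the local flows of the registered signature.
-/

namespace Summit.CriticalPhenomena.CardyFormulaZ2.Cruxes.CriticalPathRSW.FiniteSizeEnvelope

open Set MeasureTheory Filter Topology

-- adapted from the crux disprover's Disproof.lean (refuter-cdisprove-stmt-CriticalPhenomena-10267-0), item evidence 2026-08-16

section PhaseSets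

variable {U V : Set (ℝ × ℝ)}

/-- The lower envelope `cm ρ = sInf {c ≥ 0 | (ρ, c) ∉ U}` of an open set `U` is attained as soon
as some height `b ≥ 0` over `ρ` is not in `U`: `0 ≤ cm ρ ≤ b` and `(ρ, cm ρ) ∉ U`. -/
theorem env_cminus_spec {cm : ℝ → ℝ} (hcm : ∀ ρ, cm ρ = sInf {c | 0 ≤ c ∧ (ρ, c) ∉ U})
    (hU : IsOpen U) {ρ b : ℝ} (hb : 0 ≤ b) (htop : (ρ, b) ∉ U) :
    0 ≤ cm ρ ∧ (ρ, cm ρ) ∉ U ∧ cm ρ ≤ b := by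
  have hne : ({c | 0 ≤ c ∧ (ρ, c) ∉ U} : Set ℝ).Nonempty := ⟨b, hb, htop⟩
  have hbdd : BddBelow ({c | 0 ≤ c ∧ (ρ, c) ∉ U} : Set ℝ) := ⟨0, fun _ hc => hc.1⟩
  have hclosed : IsClosed ({c | 0 ≤ c ∧ (ρ, c) ∉ U} : Set ℝ) := by
    have h1 : IsClosed {c : ℝ | (ρ, c) ∉ U} := by
      have : IsOpen {c : ℝ | (ρ, c) ∈ U} := hU.preimage (Continuous.prodMk_right ρ)
      simpa [Set.compl_setOf] using this.isClosed_compl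
    exact (isClosed_Ici.inter h1 : IsClosed (Set.Ici (0 : ℝ) ∩ {c : ℝ | (ρ, c) ∉ U}))
  have hmem := hclosed.csInf_mem hne hbdd
  rw [← hcm] at hmem
  exact ⟨hmem.1, hmem.2, (hcm ρ).le.trans (csInf_le hbdd ⟨hb, htop⟩)⟩

/-- Strictly below the lower envelope (and at nonnegative height) everything is in `U`. -/
theorem env_mem_U_of_lt_cminus {cm : ℝ → ℝ} (hcm : ∀ ρ, cm ρ = sInf {c | 0 ≤ c ∧ (ρ, c) ∉ U})
    {ρ c : ℝ} (hc : 0 ≤ c) (hlt : c < cm ρ) : (ρ, c) ∈ U := by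
  by_contra h
  have : cm ρ ≤ c := (hcm ρ).le.trans (csInf_le ⟨0, fun _ hc => hc.1⟩ ⟨hc, h⟩)
  linarith

/-- The graph of the lower envelope over `[0,1]` lies in the critical set `[0,1]² ∖ (U ∪ V)`:
it is not in `U` by `env_cminus_spec` (given a non-`U` height `b ∈ [0,1]` over every `ρ`), and
not in `V` because `V` is open and a point just below the envelope would lie in `U ∩ V ∩ [0,1]²`
(or, if the envelope vanishes, because the bottom edge misses `V`). -/
theorem env_graph_mem {cm : ℝ → ℝ} (hcm : ∀ ρ, cm ρ = sInf {c | 0 ≤ c ∧ (ρ, c) ∉ U})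
    (hU : IsOpen U) (hV : IsOpen V)
    (hUV : ∀ q : ℝ × ℝ, q ∈ Icc (0 : ℝ) 1 ×ˢ Icc (0 : ℝ) 1 → q ∈ U → q ∈ V → False)
    {b : ℝ} (hb0 : 0 ≤ b) (hb1 : b ≤ 1) (htop : ∀ ρ : ℝ, 0 ≤ ρ → ρ ≤ 1 → (ρ, b) ∉ U)
    (hbot : ∀ ρ : ℝ, 0 ≤ ρ → ρ ≤ 1 → (ρ, (0 : ℝ)) ∉ V)
    {ρ : ℝ} (hρ : ρ ∈ Icc (0:ℝ) 1) :
    (ρ, cm ρ) ∈ (Icc (0:ℝ) 1 ×ˢ Icc (0:ℝ) 1) \ (U ∪ V) := by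
  obtain ⟨h0, hnU, h1⟩ := env_cminus_spec hcm hU hb0 (htop ρ hρ.1 hρ.2)
  have h1' : cm ρ ≤ 1 := h1.trans hb1
  refine ⟨⟨hρ, h0, h1'⟩, ?_⟩
  rintro (hU' | hV')
  · exact hnU hU'
  · rcases eq_or_lt_of_le h0 with hz | hpos
    · rw [← hz] at hV'; exact hbot ρ hρ.1 hρ.2 hV'
    · obtain ⟨ε, hε, hball⟩ := Metric.isOpen_iff.mp hV _ hV'
      set m := min (ε / 2) (cm ρ / 2) with hm
      have hmin_pos : 0 < m := lt_min (by linarith) (by linarith)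
      have hmin_le : m ≤ ε / 2 := min_le_left _ _
      have hmin_le' : m ≤ cm ρ / 2 := min_le_right _ _
      have hc'0 : 0 ≤ cm ρ - m := by linarith
      have hc'lt : cm ρ - m < cm ρ := by linarith
      have hc'U : (ρ, cm ρ - m) ∈ U := env_mem_U_of_lt_cminus hcm hc'0 hc'lt
      have hc'V : (ρ, cm ρ - m) ∈ V := by
        apply hball
        rw [Metric.mem_ball, Prod.dist_eq, Real.dist_eq, Real.dist_eq]
        simp only [sub_self, abs_zero]
        rw [show cm ρ - m - cm ρ = -m by ring, abs_neg, abs_of_pos hmin_pos,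
          max_eq_right hmin_pos.le]
        linarith
      exact hUV _ ⟨hρ, hc'0, hc'lt.le.trans h1'⟩ hc'U hc'V

/-- The vertical fibres of the critical set `[0,1]² ∖ (U ∪ V)` are intervals (order-connected),
because `U` is a down-set and `V` an up-set in the second coordinate. -/
theorem env_ordConnected_fibre (hUdown : ∀ ρ c c' : ℝ, c ≤ c' → (ρ, c') ∈ U → (ρ, c) ∈ U)
    (hVup : ∀ ρ c c' : ℝ, c ≤ c' → (ρ, c) ∈ V → (ρ, c') ∈ V) (ρ : ℝ) :
    Set.OrdConnected {c | (ρ, c) ∈ (Icc (0:ℝ) 1 ×ˢ Icc (0:ℝ) 1) \ (U ∪ V)} := by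
  refine ⟨fun a ha b hb c hc => ?_⟩
  refine ⟨⟨?_, ?_⟩, ?_⟩
  · rcases ha.1 with ⟨hρ, _⟩; exact hρ
  · exact ⟨ha.1.2.1.trans hc.1, hc.2.trans hb.1.2.2⟩
  · rintro (hU' | hV')
    · exact ha.2 (Or.inl (hUdown ρ a c hc.1 hU'))
    · exact hb.2 (Or.inr (hVup ρ c b hc.2 hV'))

/-- The critical set `[0,1]² ∖ (U ∪ V)` is closed when `U` and `V` are open. -/
theorem env_isClosed_K (hU : IsOpen U) (hV : IsOpen V) :
    IsClosed ((Icc (0:ℝ) 1 ×ˢ Icc (0:ℝ) 1) \ (U ∪ V)) :=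
  (isClosed_Icc.prod isClosed_Icc).sdiff (hU.union hV)

/-- Tube lemma: an open set `V` containing the top edge `[0,1] × {1}` contains a closed strip
`[0,1] × [1-δ₀, 1]` with `0 < δ₀ < 1` (compactness of the edge, `IsCompact.exists_thickening_subset_open`). -/
theorem env_tube (hV : IsOpen V) (htopV : ∀ ρ : ℝ, 0 ≤ ρ → ρ ≤ 1 → (ρ, (1 : ℝ)) ∈ V) :
    ∃ δ₀ : ℝ, 0 < δ₀ ∧ δ₀ < 1 ∧
      ∀ ρ c : ℝ, 0 ≤ ρ → ρ ≤ 1 → 1 - δ₀ ≤ c → c ≤ 1 → (ρ, c) ∈ V := by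
  have hcpt : IsCompact (Icc (0:ℝ) 1 ×ˢ ({1} : Set ℝ)) := isCompact_Icc.prod isCompact_singleton
  have hsub : Icc (0:ℝ) 1 ×ˢ ({1} : Set ℝ) ⊆ V := by
    rintro ⟨ρ, c⟩ ⟨hρ, hc⟩
    rw [Set.mem_singleton_iff] at hc
    subst hc
    exact htopV ρ hρ.1 hρ.2
  obtain ⟨δ, hδ, hthick⟩ := hcpt.exists_thickening_subset_open hV hsub
  have hmin1 := min_le_right δ 1
  have hmin2 := min_le_left δ 1
  have hminpos : 0 < min δ 1 := lt_min hδ zero_lt_one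
  refine ⟨min δ 1 / 2, by linarith, by linarith, ?_⟩
  intro ρ c hρ0 hρ1 hc1 hc2
  apply hthick
  rw [Metric.mem_thickening_iff]
  refine ⟨(ρ, 1), ⟨⟨hρ0, hρ1⟩, rfl⟩, ?_⟩
  rw [Prod.dist_eq, Real.dist_eq, Real.dist_eq]
  simp only [sub_self, abs_zero]
  rw [abs_sub_comm, abs_of_nonneg (by linarith), max_lt_iff]
  exact ⟨hδ, by linarith⟩

/-- **One-sided flow ⇒ `cm - C·id` antitone.**  If no point `(ρ, 1-δ₀)`, `ρ ∈ [0,1]`, is in the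
open set `U` (`δ₀ ≤ 1`) and `U` is invariant under the flows `(ρ, c) ↦ (ρ - t, c - C t)`
(`0 ≤ t ≤ ρ ≤ 1`, `C t ≤ c ≤ 1 - δ₀`, `C ≥ 0`), then the lower envelope satisfies
`cm ρ' ≤ cm ρ + C (ρ' - ρ)` for `0 ≤ ρ ≤ ρ' ≤ 1`: otherwise `(ρ', cm ρ + C(ρ' - ρ)) ∈ U` flows
(with `t = ρ' - ρ`) onto the envelope point `(ρ, cm ρ) ∉ U`. -/
theorem env_antitone_cminus {cm : ℝ → ℝ} (hcm : ∀ ρ, cm ρ = sInf {c | 0 ≤ c ∧ (ρ, c) ∉ U})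
    (hU : IsOpen U) {δ₀ C : ℝ} (hC : 0 ≤ C)
    (hnotU : ∀ ρ : ℝ, 0 ≤ ρ → ρ ≤ 1 → (ρ, 1 - δ₀) ∉ U) (hδ₀ : δ₀ ≤ 1)
    (hflow : ∀ ρ c t : ℝ, 0 ≤ t → t ≤ ρ → ρ ≤ 1 → C * t ≤ c → c ≤ 1 - δ₀ → (ρ, c) ∈ U →
      (ρ - t, c - C * t) ∈ U) :
    AntitoneOn (fun ρ => cm ρ - C * ρ) (Icc 0 1) := by
  intro ρ hρ ρ' hρ' hle
  obtain ⟨hg0, hgU, -⟩ := env_cminus_spec hcm hU (by linarith) (hnotU ρ hρ.1 hρ.2)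
  obtain ⟨-, -, hgle'⟩ := env_cminus_spec hcm hU (by linarith) (hnotU ρ' hρ'.1 hρ'.2)
  show cm ρ' - C * ρ' ≤ cm ρ - C * ρ
  by_contra hlt
  rw [not_le] at hlt
  have hc_lt : cm ρ + C * (ρ' - ρ) < cm ρ' := by linarith
  have hc_le : cm ρ + C * (ρ' - ρ) ≤ 1 - δ₀ := by linarith
  have ht0 : 0 ≤ ρ' - ρ := sub_nonneg.mpr hle
  have hc0 : 0 ≤ cm ρ + C * (ρ' - ρ) := add_nonneg hg0 (mul_nonneg hC ht0)
  have hcU : (ρ', cm ρ + C * (ρ' - ρ)) ∈ U := env_mem_U_of_lt_cminus hcm hc0 hc_lt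
  have hfl := hflow ρ' (cm ρ + C * (ρ' - ρ)) (ρ' - ρ) ht0 (by linarith [hρ.1]) hρ'.2
    (by linarith) hc_le hcU
  have heq : ((ρ' - (ρ' - ρ), cm ρ + C * (ρ' - ρ) - C * (ρ' - ρ)) : ℝ × ℝ) = (ρ, cm ρ) := by
    ext <;> ring
  rw [heq] at hfl
  exact hgU hfl

end PhaseSets

/-- **Stub `envelopePath` (registered signature).**  For open `U, V ⊆ ℝ²`, disjoint on `[0,1]²`,
`U` a down-set and `V` an up-set in the second coordinate, top edge in `V`, bottom edge off `V`,
`(1,0) ∉ U`, `(0,½) ∉ U ∪ V`, and `U` invariant under the flows `(ρ,c) ↦ (ρ-t, c-Ct)` on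
`c ≤ 1-δ` (`C = C(δ) ≥ 0`), there is a continuous path `γ : unitInterval → [0,1]²` from `(1,0)`
to `(0,½)` with both coordinates of bounded variation on `univ` and `γ s ∉ U`, `γ s ∉ V` for all
`s`.  Assembly of the tube lemma, the lower envelope of `[0,1]² ∖ U` and the envelope path
`env_exists_path`. -/
theorem stub_envelopePath :
  ∀ (U V : Set (ℝ × ℝ)), IsOpen U → IsOpen V →
    (∀ q : ℝ × ℝ, q ∈ Icc (0 : ℝ) 1 ×ˢ Icc (0 : ℝ) 1 → q ∈ U → q ∈ V → False) →
    (∀ ρ c c' : ℝ, c ≤ c' → (ρ, c') ∈ U → (ρ, c) ∈ U) →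
    (∀ ρ c c' : ℝ, c ≤ c' → (ρ, c) ∈ V → (ρ, c') ∈ V) →
    (∀ ρ : ℝ, 0 ≤ ρ → ρ ≤ 1 → (ρ, (1 : ℝ)) ∈ V) →
    (∀ ρ : ℝ, 0 ≤ ρ → ρ ≤ 1 → (ρ, (0 : ℝ)) ∉ V) →
    ((1 : ℝ), (0 : ℝ)) ∉ U → ((0 : ℝ), (1 / 2 : ℝ)) ∉ U → ((0 : ℝ), (1 / 2 : ℝ)) ∉ V →
    (∀ δ : ℝ, 0 < δ → δ < 1 → ∃ C : ℝ, 0 ≤ C ∧ ∀ ρ c t : ℝ, 0 ≤ t → t ≤ ρ → ρ ≤ 1 →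
        C * t ≤ c → c ≤ 1 - δ → (ρ, c) ∈ U → (ρ - t, c - C * t) ∈ U) →
    ∃ γ : unitInterval → ℝ × ℝ, Continuous γ ∧ γ 0 = (1, 0) ∧ γ 1 = (0, 1 / 2) ∧
      (∀ s, γ s ∈ Icc (0 : ℝ) 1 ×ˢ Icc (0 : ℝ) 1) ∧
      BoundedVariationOn (fun s => (γ s).1) univ ∧ BoundedVariationOn (fun s => (γ s).2) univ ∧
      ∀ s, γ s ∉ U ∧ γ s ∉ V := by
  intro U V hU hV hUV hUdown hVup htopV hbotV h10 h0U h0V hflow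
  -- tube lemma: a closed strip below the top edge lies in `V`
  obtain ⟨δ₀, hδ₀, hδ₀1, htube⟩ := env_tube hV htopV
  -- hence, by disjointness on the square, no point `(ρ, 1 - δ₀)` with `ρ ∈ [0,1]` is in `U`
  have hnotU : ∀ ρ : ℝ, 0 ≤ ρ → ρ ≤ 1 → (ρ, 1 - δ₀) ∉ U := fun ρ h0 h1 hu =>
    hUV _ ⟨⟨h0, h1⟩, by linarith, by linarith⟩ hu (htube ρ (1 - δ₀) h0 h1 le_rfl (by linarith))
  -- the flow constant at `δ = δ₀`
  obtain ⟨C, hC, hfl⟩ := hflow δ₀ hδ₀ hδ₀1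
  -- the lower envelope of the non-`U` set
  obtain ⟨cm, hcm⟩ : ∃ cm : ℝ → ℝ, ∀ ρ, cm ρ = sInf {c | 0 ≤ c ∧ (ρ, c) ∉ U} :=
    ⟨_, fun _ => rfl⟩
  -- the critical set
  have hKc : IsClosed ((Icc (0:ℝ) 1 ×ˢ Icc (0:ℝ) 1) \ (U ∪ V)) := env_isClosed_K hU hV
  have hKsub : (Icc (0:ℝ) 1 ×ˢ Icc (0:ℝ) 1) \ (U ∪ V) ⊆ Icc 0 1 ×ˢ Icc 0 1 := fun p hp => hp.1
  have hfib := env_ordConnected_fibre hUdown hVup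
  have hg : ∀ ρ ∈ Icc (0:ℝ) 1, (ρ, cm ρ) ∈ (Icc (0:ℝ) 1 ×ˢ Icc (0:ℝ) 1) \ (U ∪ V) :=
    fun ρ hρ => env_graph_mem hcm hU hV hUV (by linarith) (by linarith) hnotU hbotV hρ
  have hanti : AntitoneOn (fun ρ => cm ρ - C * ρ) (Icc 0 1) :=
    env_antitone_cminus hcm hU hC hnotU hδ₀1.le hfl
  have hg0 : cm 0 ≤ 1 / 2 := (env_cminus_spec hcm hU (by norm_num) h0U).2.2
  have h0K : ((0:ℝ), (1/2:ℝ)) ∈ (Icc (0:ℝ) 1 ×ˢ Icc (0:ℝ) 1) \ (U ∪ V) :=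
    ⟨⟨⟨le_rfl, zero_le_one⟩, by norm_num, by norm_num⟩, fun h' => h'.elim h0U h0V⟩
  have h1K : ((1:ℝ), (0:ℝ)) ∈ (Icc (0:ℝ) 1 ×ˢ Icc (0:ℝ) 1) \ (U ∪ V) :=
    ⟨⟨⟨zero_le_one, le_rfl⟩, le_rfl, zero_le_one⟩,
      fun h' => h'.elim h10 (hbotV 1 zero_le_one le_rfl)⟩
  obtain ⟨γ, hc, hγ0, hγ1, hmem, hbv1, hbv2⟩ :=
    env_exists_path hKc hKsub hfib hg hC hanti hg0 h0K h1K
  exact ⟨γ, hc, hγ0, hγ1, fun s => (hmem s).1, hbv1, hbv2,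
    fun s => ⟨fun h => (hmem s).2 (Or.inl h), fun h => (hmem s).2 (Or.inr h)⟩⟩

end Summit.CriticalPhenomena.CardyFormulaZ2.Cruxes.CriticalPathRSW.FiniteSizeEnvelope
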